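import Summits.Ventures.QEC.Census.CertScanSplit
import Summits.Ventures.QEC.Census.BB.BB108.BZAutData
import HarnessLib

/-!
# `BB108` — `bz` certificate, side Z: ENUMERATION verdicts 5/6, tier KERNEL (CERTIFIED: decide +kernel; axioms ⊆ {propext, Classical.choice, Quot.sound})

For each (block `b`, matrix `i`) listed: `cert.bzZEnum bzAutData b i = true` by `native_decide` — the
Brouwer–Zimmermann replay of matrix `i` of block `b`: every codeword `u · G_i` with `1 ≤ |u| ≤ t_i` has weight
`> wmax` or is allow-listed (CERT-FORMAT C4 / C17 (7)); tactic `decide +kernel`. KERNEL tier: each matrix ≲ 4·10⁵ codewords (type-10 22:34:29Z: 1–6·10³ visits/s in the kernel); `set_option maxHeartbeats 1000000` per theorem because one matrix exceeds the default deterministic budget of the kernel (qec-search-7: BB90 matrix of 1.6·10⁵ codewords timed out at 200000), memory guard untouched.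
Structure (`BZAutStructZ`), information sets (`BZAutInfoSetsZ*`) and bounds (`BZAutBoundsZ`) are KERNEL files.
-/

namespace Summit.Ventures.QEC.Census.BB108

set_option maxHeartbeats 1000000 in
/-- Block 2, matrix 0: the BZ enumeration verdict (`decide +kernel`; 26290 codewords). -/
theorem enumZ_2_0 : BB108.cert.bzZEnum BB108.bzAutData 2 0 = true := by
  decide +kernel

end Summit.Ventures.QEC.Census.BB108
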